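import Mathlib.Analysis.Normed.Lp.lpSpace

/-!
# NE9TableReading — the (1.36)-WEIGHTED SUP READING of channel tables into a Banach space, TOTAL and 1-LIPSCHITZ: the END's
# binder R1 `hρ` DISCHARGED GENERICALLY for the pointwise coding of tables (row NE9 OWNER's table-half design, kernel part;
# cell `pub-balaban`, T4-DAG §2 node U3 ∕ §6 NE9; BINDER row NE9 OWNER lineage `b2b-balaban-t4-ne9-p1`, generation 32;
# sheet `t4/b2b-balaban-t4-ne9-p1/g32/TABLE-HALF-NE9-g32.md` §1)

HONEST FRAMING (T4-DAG PAGE 1).  Rung (B)+1 of the FINITE-VOLUME T⁴ programme — NOT infinite volume, NOT a mass gap, NOT the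
Clay problem.  NE9 (`T4OutputRate.NE9` ∧ `FadingMemory`) is a cell NEW ESTIMATE, NOT PRINTED in [I] = [Balaban1987RG1]
(CMP **109**), [II] = [Balaban1988RG2Cluster] (CMP **116**), and NOT PROVED for Bałaban's E^{(j)} («NE9 ⇐ the named binders»;
0∕18 leaves instantiated on Bałaban's objects; spine PROVED 0∕9).  HONEST DEPENDENCY (cell line, verbatim): continuum YM on T⁴ ⇐
BetaPertH ∧ nine spine estimates (0/9 proved); BetaPertH ⇐ (D1) ∧ (D4) ∧ CAP+tail; G-an2-4 gates asym, D1 and NE2/3/4.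
`FlowStep.BetaPertH`, (B), (B^μ) do not occur.  Generic functional analysis on LETTERS (Mathlib's `lp … ∞` only); two data
definitions, no `def … : Prop`, no estimate of any object of the series; [II] quoted for TYPES only (ABSOLUTE RULE).  0 sorry.

WHY.  Every END of the lineage (END of record T4 = `NE9SizeFedCouplingSpeciesReadOut.…_margProj_fedA3`, p216114, and its `…_on`
re-cut `NE9SizeFedCouplingSpeciesReadOutOn`, gen 32) reads the channel table `Q : ι → ℝ` of the earlier terms into the configuration
space `Pot` of the activities through a map `ρ k : (ι → ℝ) → Pot` under the binder
R1 `hρ : ∀ k Q Q′ M, (∀ y, |Q y − Q′ y| ≤ wt k y · M) → ‖ρ k Q − ρ k Q′‖ ≤ M` — «the table reading is 1-Lipschitz from the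
(1.36)-weighted sup distance» ([II] (1.36) p. 9: the norm `sup_Y e^{κ d_k(Y)} |𝐕′_k(Y)|` of the inserted potentials; WALL-NE9-P1 §2
row R1, class M).  THIS FILE DISCHARGES R1 ONCE AND FOR ALL for the natural reading: `Pot := lp (fun _ : ι => ℂ) ∞` (bounded complex
tables, a Banach space — Mathlib), `ρ k Q :=` the weight-divided table `y ↦ Q y ∕ wt k y` when it is bounded, `0` otherwise
(`reading`).  The junk value is HARMLESS for R1: if `Q − Q′` is weighted-bounded then `Q` and `Q′` are weighted-bounded TOGETHER or
not at all (`Memℓp.sub`∕`.add`), so the two branches never meet inside the binder (§2 `norm_reading_sub_le`).  It is NOT harmless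
for the box binder of the landed ENDs (`hbox`: ALL tables of the box read into the admissible set `𝒜 k` on which the displayed
`TwoPointKP` speaks) when the activity is measure-theoretic in a field argument coded pointwise in `ι` — which is why gen 32 re-cut
the ENDs to `hboxOn` (arising tables only; `NE9BridgeSizeInductionOn` ff.); with `𝒜 k :=` the readings of the ARISING box tables,
`hboxOn` is then definitionally true and the values are recovered entrywise (§1 `reading_apply_of_bound`).
* §1 `wfun wt Q` (the weight-divided complex table), `reading wt Q : lp (fun _ : ι => ℂ) ∞`; `memℓp_wfun_of_bound`,
  `reading_coe_of_mem ∕ reading_of_not_mem`, **`reading_apply_of_bound`** (entries `Q y ∕ wt y` on the weighted box),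
  **`norm_reading_le_of_bound`** (box of weighted radius `S` ↦ ball of radius `S`);
* §2 **`norm_reading_sub_le`** — R1: `(∀ y, |Q y − Q′ y| ≤ wt y · M) → ‖reading wt Q − reading wt Q′‖ ≤ M` (positive weights,
  `ι` nonempty); level-indexed packaging **`hρ_reading`** = the END's binder `hρ` LITERALLY for `ρ k := reading (wt k)`.
DISGUISE TEST: a reading map and its Lipschitz property; no activity, no species, no estimate; not NE9.

References (TYPES only): [Balaban1988RG2Cluster] T. Bałaban, CMP **116** (1988) 1–22, (1.36) p. 9.  Summits-side NEW work (LEAN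
PLACEMENT RULE); Mathlib only; modifies nothing.  Value = one M-row of WALL-NE9-P1 §2 (R1 `hρ`) made K for the pointwise coding.
-/

noncomputable section

namespace Summit.QuantumFields.BalabanUV.T4Continuum.NE9TableReading

open scoped ENNReal

variable {ι : Type*}

/-! ## §1 The weighted reading into `ℓ^∞(ι, ℂ)` -/

/-- [folklore] DATA: the weight-divided complex table `y ↦ Q y ∕ wt y`. [cite: Balaban1988RG2Cluster, (1.36) p.9] -/
def wfun (wt : ι → ℝ) (Q : ι → ℝ) : ι → ℂ := fun y => ((Q y / wt y : ℝ) : ℂ)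

/-- [folklore] `wfun` unfolds. -/
@[simp] theorem wfun_apply (wt : ι → ℝ) (Q : ι → ℝ) (y : ι) : wfun wt Q y = ((Q y / wt y : ℝ) : ℂ) := rfl

/-- [folklore] the norm of an entry of the weight-divided table: `‖wfun wt Q y‖ = |Q y| ∕ wt y` for a positive weight. -/
theorem norm_wfun_apply {wt : ι → ℝ} (hwt : ∀ y, 0 < wt y) (Q : ι → ℝ) (y : ι) : ‖wfun wt Q y‖ = |Q y| / wt y := by
  rw [wfun_apply, Complex.norm_real, Real.norm_eq_abs, abs_div, abs_of_pos (hwt y)]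

/-- [folklore] `wfun` is additive in the table: `wfun wt Q − wfun wt Q′ = wfun wt (Q − Q′)`. -/
theorem wfun_sub (wt : ι → ℝ) (Q Q' : ι → ℝ) : wfun wt Q - wfun wt Q' = wfun wt (Q - Q') := by
  funext y
  simp only [Pi.sub_apply, wfun_apply, sub_div, Complex.ofReal_sub]

/-- [folklore] a table in the weighted box of radius `M` has a BOUNDED weight-divided table (`Memℓp … ∞`). -/
theorem memℓp_wfun_of_bound {wt : ι → ℝ} (hwt : ∀ y, 0 < wt y) {Q : ι → ℝ} {M : ℝ} (h : ∀ y, |Q y| ≤ wt y * M) :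
    Memℓp (wfun wt Q) ∞ := by
  refine memℓp_infty ⟨M, ?_⟩
  rintro _ ⟨y, rfl⟩
  show ‖wfun wt Q y‖ ≤ M
  rw [norm_wfun_apply hwt]
  exact (div_le_iff₀ (hwt y)).mpr (by rw [mul_comm]; exact h y)

open Classical in
/-- [folklore] DATA: **THE WEIGHTED READING** `reading wt Q : lp (fun _ : ι => ℂ) ∞` — the weight-divided table when it is bounded,
the zero table otherwise (the two cases never meet inside R1, §2). [cite: Balaban1988RG2Cluster, (1.36) p.9] -/
def reading (wt : ι → ℝ) (Q : ι → ℝ) : lp (fun _ : ι => ℂ) ∞ :=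
  if h : Memℓp (wfun wt Q) ∞ then ⟨wfun wt Q, h⟩ else 0

/-- [folklore] on bounded weight-divided tables the reading IS the table. -/
theorem reading_coe_of_mem {wt : ι → ℝ} {Q : ι → ℝ} (h : Memℓp (wfun wt Q) ∞) :
    ((reading wt Q : lp (fun _ : ι => ℂ) ∞) : ι → ℂ) = wfun wt Q := by
  rw [reading, dif_pos h]

/-- [folklore] off them the reading is `0`. -/
theorem reading_of_not_mem {wt : ι → ℝ} {Q : ι → ℝ} (h : ¬ Memℓp (wfun wt Q) ∞) : reading wt Q = 0 := by
  rw [reading, dif_neg h]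

/-- [folklore] **THE ENTRIES ON THE WEIGHTED BOX**: for `|Q y| ≤ wt y · M` everywhere, `reading wt Q y = Q y ∕ wt y` — the activity
reads the VALUES of an arising table back from its reading (`Q y = wt y · re (reading wt Q y)`). -/
theorem reading_apply_of_bound {wt : ι → ℝ} (hwt : ∀ y, 0 < wt y) {Q : ι → ℝ} {M : ℝ} (h : ∀ y, |Q y| ≤ wt y * M)
    (y : ι) : (reading wt Q : ι → ℂ) y = ((Q y / wt y : ℝ) : ℂ) := by
  rw [reading_coe_of_mem (memℓp_wfun_of_bound hwt h), wfun_apply]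

/-- [folklore] the value recovered from the reading on the weighted box: `wt y · re (reading wt Q y) = Q y`. -/
theorem mul_re_reading_apply_of_bound {wt : ι → ℝ} (hwt : ∀ y, 0 < wt y) {Q : ι → ℝ} {M : ℝ}
    (h : ∀ y, |Q y| ≤ wt y * M) (y : ι) : wt y * ((reading wt Q : ι → ℂ) y).re = Q y := by
  rw [reading_apply_of_bound hwt h, Complex.ofReal_re, mul_div_cancel₀ _ (hwt y).ne']

/-- [folklore] **THE WEIGHTED BOX IS READ INTO THE BALL**: `|Q y| ≤ wt y · S` everywhere ⇒ `‖reading wt Q‖ ≤ S` (`ι` nonempty). -/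
theorem norm_reading_le_of_bound [Nonempty ι] {wt : ι → ℝ} (hwt : ∀ y, 0 < wt y) {Q : ι → ℝ} {S : ℝ}
    (h : ∀ y, |Q y| ≤ wt y * S) : ‖reading wt Q‖ ≤ S := by
  refine lp.norm_le_of_forall_le' S fun y => ?_
  rw [reading_coe_of_mem (memℓp_wfun_of_bound hwt h), norm_wfun_apply hwt]
  exact (div_le_iff₀ (hwt y)).mpr (by rw [mul_comm]; exact h y)

/-! ## §2 R1: the reading is 1-Lipschitz from the weighted sup distance — TOTAL, junk branch included -/

/-- [folklore] **R1 `hρ` DISCHARGED**: for positive weights on a nonempty index, `(∀ y, |Q y − Q′ y| ≤ wt y · M) →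
‖reading wt Q − reading wt Q′‖ ≤ M`.  Cases: both weight-divided tables bounded — entrywise; exactly one bounded — impossible, since
their difference is bounded by hypothesis (`Memℓp.sub` ∕ `Memℓp.add`); neither — both readings are `0` and `0 ≤ M`.
[cite: Balaban1988RG2Cluster, (1.36) p.9] -/
theorem norm_reading_sub_le [Nonempty ι] {wt : ι → ℝ} (hwt : ∀ y, 0 < wt y) {Q Q' : ι → ℝ} {M : ℝ}
    (h : ∀ y, |Q y - Q' y| ≤ wt y * M) : ‖reading wt Q - reading wt Q'‖ ≤ M := by
  obtain ⟨y₀⟩ := ‹Nonempty ι›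
  have hM : 0 ≤ M := (mul_nonneg_iff_of_pos_left (hwt y₀)).mp ((abs_nonneg _).trans (h y₀))
  have hd : Memℓp (wfun wt Q - wfun wt Q') ∞ := by
    rw [wfun_sub]
    exact memℓp_wfun_of_bound hwt (Q := Q - Q') (fun y => by simpa only [Pi.sub_apply] using h y)
  by_cases hQ : Memℓp (wfun wt Q) ∞
  · by_cases hQ' : Memℓp (wfun wt Q') ∞
    · refine lp.norm_le_of_forall_le' M fun y => ?_
      rw [lp.coeFn_sub, Pi.sub_apply, reading_coe_of_mem hQ, reading_coe_of_mem hQ', ← Pi.sub_apply (wfun wt Q),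
        wfun_sub, norm_wfun_apply hwt, Pi.sub_apply]
      exact (div_le_iff₀ (hwt y)).mpr (by rw [mul_comm]; exact h y)
    · exact absurd (by simpa only [sub_sub_cancel] using hQ.sub hd) hQ'
  · by_cases hQ' : Memℓp (wfun wt Q') ∞
    · exact absurd (by simpa only [sub_add_cancel] using hd.add hQ') hQ
    · rw [reading_of_not_mem hQ, reading_of_not_mem hQ', sub_zero, norm_zero]
      exact hM

/-- [folklore] DATA: the level-indexed reading `ρ k := reading (wt k)` of the END's binder list. -/
def readingρ (wt : ℕ → ι → ℝ) : ℕ → (ι → ℝ) → lp (fun _ : ι => ℂ) ∞ := fun k => reading (wt k)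

/-- [folklore] **THE END's BINDER `hρ` LITERALLY, for `ρ := readingρ wt`** (positive weights, nonempty index):
`∀ k Q Q′ M, (∀ y, |Q y − Q′ y| ≤ wt k y · M) → ‖readingρ wt k Q − readingρ wt k Q′‖ ≤ M`. [cite: Balaban1988RG2Cluster, (1.36) p.9] -/
theorem hρ_reading [Nonempty ι] {wt : ℕ → ι → ℝ} (hwt : ∀ k y, 0 < wt k y) :
    ∀ (k : ℕ) (Q Q' : ι → ℝ) (M : ℝ), (∀ y, |Q y - Q' y| ≤ wt k y * M) → ‖readingρ wt k Q - readingρ wt k Q'‖ ≤ M :=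
  fun k _ _ _ h => norm_reading_sub_le (hwt k) h

/-- [folklore] **… AND THE BOX HALF**: a table of the level-`k` weighted box of radius `S` is read into the ball of radius `S`, with
entries `Q y ∕ wt k y` — so with `𝒜 k :=` «readings of the ARISING box tables» the re-cut binder `hboxOn` holds by definition and
the activity recovers the arising table's values. -/
theorem readingρ_box [Nonempty ι] {wt : ℕ → ι → ℝ} (hwt : ∀ k y, 0 < wt k y) {k : ℕ} {Q : ι → ℝ} {S : ℝ}
    (h : ∀ y, |Q y| ≤ wt k y * S) :
    ‖readingρ wt k Q‖ ≤ S ∧ ∀ y, (readingρ wt k Q : ι → ℂ) y = ((Q y / wt k y : ℝ) : ℂ) :=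
  ⟨norm_reading_le_of_bound (hwt k) h, reading_apply_of_bound (hwt k) h⟩

end Summit.QuantumFields.BalabanUV.T4Continuum.NE9TableReading

end
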